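import Summits.CriticalPhenomena.CardyFormulaZ2.Theorems.CardySelfDualSegmentUniformBoxCrossingDefs
import HarnessLib

/-!
# Stub `stub_cover` of line `Sketch` (crux stmt-CriticalPhenomena-5476 `UniformBoxCrossing`), part 1:
# the interface lemma of the lower hull

Bollobás–Riordan, *Percolation on self-dual polygon configurations* (2010, arXiv:1001.4674),
§5.1 (remark before Lemma 5.5 and proof of Lemma 5.6), planar step, for the canonical regions of
`…UniformBoxCrossingDefs.lean`: the lower region `A = lowerRegion n ω` of the square
`S₁ = [0, n]²` ("on or below the lowest open horizontal crossing") can only be entered, inside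
the strip `0 ≤ x₀ ≤ n`, through a vertex of the lowest crossing. Precisely
(`mem_support_of_adj_region`): if `a ∈ A`, `u ∉ A`, `a ∼ u`, both in the strip, then `a` is a
vertex of every interface walk `w` of the lower hull whose extension `extendRight w.walk 0`
winds `-1` around the hull faces and `0` around the other faces of the dual square (the
winding-number bridge `BridgeStatement`, a neighbouring stub, supplies this for the walks of
`exists_lowerInterfaceWalk`).

Proof: around `a` there is a hull face and — across one of the four lattice edges at `a` — a
face of the dual square outside the hull (`exists_isBdryEdge_of_adj`, a case analysis over the
four faces around `a` and the four positions of `u`; the two faces of the edge `{a, u}` are faces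
around `u`, hence not hull faces; the walls `x₀ = 0, n` are where the choice of the edge
matters); such a hull-boundary edge is an edge of `w` (`mem_edges_of_isBdryEdge`), since
otherwise its two faces would have the same winding number
(`walkWinding_eq_walkWinding_right/up`).

`exists_interface` packages, for a lattice configuration with `H(S₁)`, an interface walk that is
an open left–right crossing of `S₁` with this no-entry property; part 2 (`…StubCoverPart2.lean`)
transports it to the reflected and translated frames, and `…StubCover.lean` derives the cover
and disjointness statements `CoverStatement`.
-/

noncomputable section

namespace Summit.CriticalPhenomena.CardyFormulaZ2.Cruxes.UniformBoxCrossing.NonSlantLine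

open SimpleGraph Finset Literature.Probability.Percolation Literature.Probability.LatticeModels

section Base

variable {n : ℕ} {ω : BondConfig (Site 2)}

/-- On `H([0,n]²)` (no top face explored) no top face of the dual square lies in the lower hull.
[folklore] -/
theorem not_mem_lowerHull_of_mem_dualTopSide (htop : ∀ f ∈ dualTopSide n n, f ∉ dualBelow n ω)
    {f : Site 2} (hf : f ∈ dualTopSide n n) : f ∉ lowerHull n ω := by
  intro hfH
  refine ((mem_lowerHull_iff n).1 hfH).2 ⟨f, hf, f, rfl, openConnIn_refl ?_⟩
  exact ⟨Finset.mem_coe.2 (Finset.mem_filter.1 hf).1, htop f hf⟩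

/-- Coordinates of a hull face: `0 ≤ g₀ ≤ n - 1`, `-1 ≤ g₁ ≤ n - 1`. [folklore] -/
theorem lowerHull_bounds (htop : ∀ f ∈ dualTopSide n n, f ∉ dualBelow n ω) {g : Site 2}
    (hg : g ∈ lowerHull n ω) : 0 ≤ g 0 ∧ g 0 + 1 ≤ n ∧ -1 ≤ g 1 ∧ g 1 + 1 ≤ n := by
  have hgD := ((mem_lowerHull_iff n).1 hg).1
  have hgR := mem_dualRectangle_iff.1 hgD
  have hne : g 1 ≠ n := fun h =>
    not_mem_lowerHull_of_mem_dualTopSide htop (Finset.mem_filter.2 ⟨hgD, h⟩) hg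
  omega

/-- The lower region lies at heights `≤ n`. [folklore] -/
theorem apply_one_le_of_mem_lowerRegion (htop : ∀ f ∈ dualTopSide n n, f ∉ dualBelow n ω)
    {z : Site 2} (hz : z ∈ lowerRegion n ω) : z 1 ≤ n := by
  rcases hz with hz | ⟨g, hg, hgH⟩
  · omega
  · have hb := lowerHull_bounds htop hgH
    rcases mem_facesAt_iff.1 hg with rfl | rfl | rfl | rfl
    · omega
    all_goals
      simp only [Pi.sub_apply, single_zero_apply_one, single_one_apply_one] at hb
      omega

/-- The bottom row of the square (and everything below it, inside the strip) lies in the lower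
region: the bottom faces are explored. [folklore] -/
theorem mem_lowerRegion_of_le_zero (hn : 1 ≤ n) {z : Site 2} (hz0 : 0 ≤ z 0) (hz0' : z 0 ≤ n)
    (hz1 : z 1 ≤ 0) : z ∈ lowerRegion n ω := by
  rcases lt_or_eq_of_le hz1 with h | h
  · exact Or.inl h
  · right
    by_cases hx : z 0 + 1 ≤ n
    · refine ⟨z - Pi.single 1 1, mem_facesAt_iff.2 (Or.inr (Or.inr (Or.inl rfl))),
        dualBelow_subset_lowerHull n ω (mem_dualBelow_of_mem_dualBottomSide ?_)⟩
      simp only [dualBottomSide, Finset.mem_filter, mem_dualRectangle_iff, Pi.sub_apply,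
        single_one_apply_zero, single_one_apply_one]
      omega
    · refine ⟨z - Pi.single 0 1 - Pi.single 1 1, mem_facesAt_iff.2 (Or.inr (Or.inr (Or.inr rfl))),
        dualBelow_subset_lowerHull n ω (mem_dualBelow_of_mem_dualBottomSide ?_)⟩
      simp only [dualBottomSide, Finset.mem_filter, mem_dualRectangle_iff, Pi.sub_apply,
        single_one_apply_zero, single_one_apply_one, single_zero_apply_zero, single_zero_apply_one]
      omega

/-- No face around a point outside the lower region is a hull face. [folklore] -/
theorem not_mem_lowerHull_of_not_mem_lowerRegion {u g : Site 2} (hu : u ∉ lowerRegion n ω)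
    (hg : g ∈ facesAt u) : g ∉ lowerHull n ω :=
  fun h => hu (Or.inr ⟨g, hg, h⟩)

/-- A lattice edge one of whose faces is a hull face and the other a face of the dual square
outside the hull is a hull-boundary edge (either orientation of the dual edge). [folklore] -/
theorem isBdryEdge_lowerHull_of_faces {e : Sym2 (Site 2)} {g g' : Site 2}
    (hde : dualEdge e = s(g, g') ∨ dualEdge e = s(g', g)) (hg : g ∈ lowerHull n ω)
    (hg'R : g' ∈ dualRectangle n n) (hg' : g' ∉ lowerHull n ω) : IsBdryEdge (lowerHull n ω) n e := by
  have hgR := ((mem_lowerHull_iff n).1 hg).1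
  rcases hde with hde | hde
  · exact ⟨g, g', hde, hgR, hg'R, hg, hg'⟩
  · exact ⟨g, g', by rw [hde, Sym2.eq_swap], hgR, hg'R, hg, hg'⟩

/-- **A hull-boundary edge at the exit vertex.** If `a ∈ lowerRegion n ω`, `u ∉ lowerRegion n ω`,
`a ∼ u` and both lie in the strip `0 ≤ x₀ ≤ n` (on `H([0,n]²)`, `n ≥ 1`), then some lattice edge
at `a` separates a hull face from a face of the dual square outside the hull: around `a` there is
a hull face, the two faces of the edge `{a, u}` (faces around `u`) are not hull faces, and the
edge of the dual square between a hull face and a non-hull face around `a` is found by a case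
analysis (on the walls `x₀ = 0, n` it is the horizontal edge at `a` pointing into the square).
[cite: BollobasRiordan2010, §5.1 proof of Thm. 5.3] -/
theorem exists_isBdryEdge_of_adj (hn : 1 ≤ n) (htop : ∀ f ∈ dualTopSide n n, f ∉ dualBelow n ω)
    {a u : Site 2} (ha : a ∈ lowerRegion n ω) (hu : u ∉ lowerRegion n ω)
    (hadj : (zdGraph 2).Adj a u) (ha0 : 0 ≤ a 0) (ha0' : a 0 ≤ n) (hu0 : 0 ≤ u 0) (hu0' : u 0 ≤ n) :
    ∃ e ∈ (zdGraph 2).edgeSet, a ∈ e ∧ IsBdryEdge (lowerHull n ω) n e := by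
  have hu1 : 0 ≤ u 1 := by
    by_contra h
    exact hu (Or.inl (by omega))
  have ha1 : 0 ≤ a 1 := by
    by_contra h
    have hle := (zdGraph_adj_apply_le hadj 1).1
    exact hu (mem_lowerRegion_of_le_zero hn hu0 hu0' (by omega))
  obtain ⟨g, hg, hgH⟩ : ∃ g ∈ facesAt a, g ∈ lowerHull n ω := by
    rcases ha with ha | ha
    · omega
    · exact ha
  have hb := lowerHull_bounds htop hgH
  have hnh : ∀ g' ∈ facesAt u, g' ∉ lowerHull n ω := fun g' hg' =>
    not_mem_lowerHull_of_not_mem_lowerRegion hu hg'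
  -- the bookkeeping common to all cases
  have main : ∀ (e : Sym2 (Site 2)) (g' : Site 2), e ∈ (zdGraph 2).edgeSet → a ∈ e →
      (dualEdge e = s(g, g') ∨ dualEdge e = s(g', g)) → g' ∈ facesAt u → g' ∈ dualRectangle n n →
      ∃ e ∈ (zdGraph 2).edgeSet, a ∈ e ∧ IsBdryEdge (lowerHull n ω) n e :=
    fun e g' he hae hde hg'u hg'R =>
      ⟨e, he, hae, isBdryEdge_lowerHull_of_faces hde hgH hg'R (hnh g' hg'u)⟩
  rcases Fin.exists_fin_two.1 ((zdGraph_adj_iff a u).1 hadj) with (rfl | rfl) | (rfl | rfl)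
  · -- `u = a + e₀`: the faces `a`, `a - e₁` of `{a, u}` are not hull faces
    simp only [Pi.add_apply, single_zero_apply_zero] at hu0'
    rcases mem_facesAt_iff.1 hg with rfl | rfl | rfl | rfl
    · exact absurd hgH (hnh _ (mem_facesAt_iff.2 (Or.inr (Or.inl (by abel)))))
    · -- hull face `a - e₀`: the vertical edge `{a, a + e₁}`
      refine main s(a, a + Pi.single 1 1) a (single_edge_mem a 1) (Sym2.mem_mk_left _ _)
        (Or.inl (dualEdge_vertical a)) (mem_facesAt_iff.2 (Or.inr (Or.inl (by abel)))) ?_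
      simp only [Pi.sub_apply, single_zero_apply_zero, single_zero_apply_one] at hb
      simp only [mem_dualRectangle_iff]
      omega
    · exact absurd hgH (hnh _ (mem_facesAt_iff.2 (Or.inr (Or.inr (Or.inr (by abel))))))
    · -- hull face `a - e₀ - e₁`: the vertical edge `{a - e₁, a}`
      refine main s(a - Pi.single 1 1, a - Pi.single 1 1 + Pi.single 1 1) (a - Pi.single 1 1)
        (single_edge_mem _ 1) (by rw [sub_add_cancel]; exact Sym2.mem_mk_right _ _)
        (Or.inl (by rw [dualEdge_vertical, sub_right_comm]))
        (mem_facesAt_iff.2 (Or.inr (Or.inr (Or.inr (by abel))))) ?_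
      simp only [Pi.sub_apply, single_zero_apply_zero, single_zero_apply_one, single_one_apply_zero,
        single_one_apply_one] at hb
      simp only [mem_dualRectangle_iff, Pi.sub_apply, single_one_apply_zero, single_one_apply_one]
      omega
  · -- `a = u + e₀`: the faces `u`, `u - e₁` of `{a, u}` are not hull faces
    simp only [Pi.add_apply, single_zero_apply_zero, single_zero_apply_one] at ha0' ha1
    rcases mem_facesAt_iff.1 hg with rfl | rfl | rfl | rfl
    · -- hull face `a`: the vertical edge `{a, a + e₁}`
      refine main s(u + Pi.single 0 1, u + Pi.single 0 1 + Pi.single 1 1) u (single_edge_mem _ 1)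
        (Sym2.mem_mk_left _ _) (Or.inr (by rw [dualEdge_vertical, add_sub_cancel_right]))
        (mem_facesAt_iff.2 (Or.inl rfl)) ?_
      simp only [Pi.add_apply, single_zero_apply_zero, single_zero_apply_one] at hb
      simp only [mem_dualRectangle_iff]
      omega
    · exact absurd hgH (hnh _ (mem_facesAt_iff.2 (Or.inl (by abel))))
    · -- hull face `a - e₁`: the vertical edge `{a - e₁, a}`
      refine main s(u + Pi.single 0 1 - Pi.single 1 1, u + Pi.single 0 1 - Pi.single 1 1 + Pi.single 1 1)
        (u - Pi.single 1 1) (single_edge_mem _ 1) (by rw [sub_add_cancel]; exact Sym2.mem_mk_right _ _)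
        (Or.inr (by rw [dualEdge_vertical]; congr 1; abel))
        (mem_facesAt_iff.2 (Or.inr (Or.inr (Or.inl rfl)))) ?_
      simp only [Pi.add_apply, Pi.sub_apply, single_zero_apply_zero, single_zero_apply_one,
        single_one_apply_zero, single_one_apply_one] at hb
      simp only [mem_dualRectangle_iff, Pi.sub_apply, single_one_apply_zero, single_one_apply_one]
      omega
    · exact absurd hgH (hnh _ (mem_facesAt_iff.2 (Or.inr (Or.inr (Or.inl (by abel))))))
  · -- `u = a + e₁`: the faces `a`, `a - e₀` of `{a, u}` are not hull faces
    rcases mem_facesAt_iff.1 hg with rfl | rfl | rfl | rfl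
    · exact absurd hgH (hnh _ (mem_facesAt_iff.2 (Or.inr (Or.inr (Or.inl (by abel))))))
    · exact absurd hgH (hnh _ (mem_facesAt_iff.2 (Or.inr (Or.inr (Or.inr (by abel))))))
    · -- hull face `a - e₁`: the horizontal edge `{a, a + e₀}`
      refine main s(a, a + Pi.single 0 1) a (single_edge_mem a 0) (Sym2.mem_mk_left _ _)
        (Or.inl (dualEdge_horizontal a)) (mem_facesAt_iff.2 (Or.inr (Or.inr (Or.inl (by abel))))) ?_
      simp only [Pi.sub_apply, single_one_apply_zero, single_one_apply_one] at hb
      simp only [mem_dualRectangle_iff]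
      omega
    · -- hull face `a - e₀ - e₁`: the horizontal edge `{a - e₀, a}`
      refine main s(a - Pi.single 0 1, a - Pi.single 0 1 + Pi.single 0 1) (a - Pi.single 0 1)
        (single_edge_mem _ 0) (by rw [sub_add_cancel]; exact Sym2.mem_mk_right _ _)
        (Or.inl (dualEdge_horizontal _)) (mem_facesAt_iff.2 (Or.inr (Or.inr (Or.inr (by abel))))) ?_
      simp only [Pi.sub_apply, single_zero_apply_zero, single_zero_apply_one, single_one_apply_zero,
        single_one_apply_one] at hb
      simp only [mem_dualRectangle_iff, Pi.sub_apply, single_zero_apply_zero, single_zero_apply_one]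
      omega
  · -- `a = u + e₁`: the faces `u`, `u - e₀` of `{a, u}` are not hull faces
    simp only [Pi.add_apply, single_one_apply_zero, single_one_apply_one] at ha0 ha0' ha1
    rcases mem_facesAt_iff.1 hg with rfl | rfl | rfl | rfl
    · -- hull face `a`: the horizontal edge `{a, a + e₀}`
      refine main s(u + Pi.single 1 1, u + Pi.single 1 1 + Pi.single 0 1) u (single_edge_mem _ 0)
        (Sym2.mem_mk_left _ _) (Or.inr (by rw [dualEdge_horizontal, add_sub_cancel_right]))
        (mem_facesAt_iff.2 (Or.inl rfl)) ?_
      simp only [Pi.add_apply, single_one_apply_zero, single_one_apply_one] at hb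
      simp only [mem_dualRectangle_iff]
      omega
    · -- hull face `a - e₀`: the horizontal edge `{a - e₀, a}`
      refine main s(u + Pi.single 1 1 - Pi.single 0 1, u + Pi.single 1 1 - Pi.single 0 1 + Pi.single 0 1)
        (u - Pi.single 0 1) (single_edge_mem _ 0) (by rw [sub_add_cancel]; exact Sym2.mem_mk_right _ _)
        (Or.inr (by rw [dualEdge_horizontal]; congr 1; abel))
        (mem_facesAt_iff.2 (Or.inr (Or.inl rfl))) ?_
      simp only [Pi.add_apply, Pi.sub_apply, single_zero_apply_zero, single_zero_apply_one,
        single_one_apply_zero, single_one_apply_one] at hb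
      simp only [mem_dualRectangle_iff, Pi.sub_apply, single_zero_apply_zero, single_zero_apply_one]
      omega
    · exact absurd hgH (hnh _ (mem_facesAt_iff.2 (Or.inl (by abel))))
    · exact absurd hgH (hnh _ (mem_facesAt_iff.2 (Or.inr (Or.inl (by abel)))))

/-- A square crossing lies in `[0, n]²` (coordinates). [folklore] -/
theorem squareCrossing_bounds {w : XWalk} (hw : IsSquareCrossing n w.walk) {z : Site 2}
    (hz : z ∈ w.walk.support) : 0 ≤ z 0 ∧ z 0 ≤ n ∧ 0 ≤ z 1 ∧ z 1 ≤ n :=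
  mem_rectangle_iff.1 (hw.subset z hz)

/-- The end `(n + 1, -2)` of the extension `extendRight w.walk 0` of a square crossing is off every
half-line `rayAbove z` with `z₁ ≥ -2`. [folklore] -/
theorem extendRight_end_notMem_rayAbove {w : XWalk} (hw : IsSquareCrossing n w.walk) {z : Site 2}
    (hz : -2 ≤ z 1) :
    ((fun y : Site 2 => y - Pi.single 1 1)^[(w.snd 1 - 0).toNat + 2] (w.snd + Pi.single 0 1)) ∉ rayAbove z := by
  have h1 := (extendRight_end_apply w.snd (B := 0) (squareCrossing_bounds hw w.walk.end_mem_support).2.2.1).2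
  simp only [mem_rayAbove, not_and]
  intro h
  rw [h1] at h
  omega

/-- Edges of the square (both endpoints at `x₀ ≤ n`) that are not edges of `w` are not edges of
the extension `extendRight w.walk 0` (whose extra edges have an endpoint in the column
`x₀ = n + 1`). [folklore] -/
theorem not_mem_edges_extendRight {w : XWalk} (hw : IsSquareCrossing n w.walk) {x y : Site 2}
    (hxy : s(x, y) ∉ w.walk.edges) (hx : x 0 ≤ n) (hy : y 0 ≤ n) :
    s(x, y) ∉ (extendRight w.walk 0).edges := by
  intro h
  rcases mem_edges_extendRight h with h | ⟨z, hz, hz0⟩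
  · exact hxy h
  · rw [hw.finish] at hz0
    rcases Sym2.mem_iff.1 hz with rfl | rfl <;> omega

/-- **Hull-boundary edges are edges of the interface walk.** If `extendRight w.walk 0` winds `-1`
around every hull face and `0` around every other face of the dual square, then every lattice
edge separating a hull face from a non-hull face of the dual square is an edge of `w`: otherwise
the winding numbers of its two faces would agree (`walkWinding_eq_walkWinding_right`,
`walkWinding_eq_walkWinding_up`). [cite: BollobasRiordan2010, §5.1 proof of Thm. 5.3] -/
theorem mem_edges_of_isBdryEdge {w : XWalk} (hw : IsSquareCrossing n w.walk)
    (hW1 : ∀ f ∈ lowerHull n ω, walkWinding (extendRight w.walk 0) f = -1)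
    (hW0 : ∀ f ∈ dualRectangle n n, f ∉ lowerHull n ω → walkWinding (extendRight w.walk 0) f = 0)
    {e : Sym2 (Site 2)} (he : e ∈ (zdGraph 2).edgeSet) (hb : IsBdryEdge (lowerHull n ω) n e) :
    e ∈ w.walk.edges := by
  by_contra hne
  obtain ⟨g, g', hde, hgR, hg'R, hg, hg'⟩ := hb
  have h1 := hW1 g hg
  have h0 := hW0 g' hg'R hg'
  have hgR' := mem_dualRectangle_iff.1 hgR
  have hg'R' := mem_dualRectangle_iff.1 hg'R
  obtain ⟨x, hi⟩ := mem_edgeSet_zdGraph_iff.1 he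
  rcases Fin.exists_fin_two.1 hi with rfl | rfl
  · -- horizontal edge `{x, x + e₀}`, faces `x - e₁`, `x`
    rw [dualEdge_horizontal] at hde
    have hx : x ∈ s(g, g') := hde ▸ Sym2.mem_mk_right _ _
    have hx0 : 0 ≤ x 0 ∧ x 0 + 1 ≤ n ∧ -1 ≤ x 1 := by
      rcases Sym2.mem_iff.1 hx with rfl | rfl <;> omega
    have hext : s(x, x + Pi.single 0 1) ∉ (extendRight w.walk 0).edges :=
      not_mem_edges_extendRight hw hne (by omega) (by simp; omega)
    have key : walkWinding (extendRight w.walk 0) (x - Pi.single 1 1) =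
        walkWinding (extendRight w.walk 0) x := by
      have := walkWinding_eq_walkWinding_up (p := extendRight w.walk 0) (u := x - Pi.single 1 1)
        (by rw [sub_add_cancel]; exact hext) (hw.start_notMem_rayAbove (by simp; omega))
        (extendRight_end_notMem_rayAbove hw (by simp; omega))
      rwa [sub_add_cancel] at this
    rcases Sym2.eq_iff.1 hde with ⟨h₁, h₂⟩ | ⟨h₁, h₂⟩
    · rw [h₁, h₂] at key; omega
    · rw [h₁, h₂] at key; omega
  · -- vertical edge `{x, x + e₁}`, faces `x - e₀`, `x`
    rw [dualEdge_vertical] at hde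
    have hx : x ∈ s(g, g') := hde ▸ Sym2.mem_mk_right _ _
    have hx0 : x 0 + 1 ≤ n := by
      rcases Sym2.mem_iff.1 hx with rfl | rfl <;> omega
    have hext : s(x, x + Pi.single 1 1) ∉ (extendRight w.walk 0).edges :=
      not_mem_edges_extendRight hw hne (by omega) (by simp; omega)
    have key : walkWinding (extendRight w.walk 0) (x - Pi.single 0 1) =
        walkWinding (extendRight w.walk 0) x := by
      have := walkWinding_eq_walkWinding_right (p := extendRight w.walk 0) (u := x - Pi.single 0 1)
        (by rw [sub_add_cancel]; exact hext)
      rwa [sub_add_cancel] at this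
    rcases Sym2.eq_iff.1 hde with ⟨h₁, h₂⟩ | ⟨h₁, h₂⟩
    · rw [h₁, h₂] at key; omega
    · rw [h₁, h₂] at key; omega

/-- **The interface lemma (no entry into the lower region off the crossing).** On `H([0,n]²)`,
`n ≥ 1`: if `a ∈ lowerRegion n ω`, `u ∉ lowerRegion n ω`, `a ∼ u`, both in the strip
`0 ≤ x₀ ≤ n`, then `a` is a vertex of every interface walk `w` of the lower hull with the
winding-number property. (Bollobás–Riordan's "the minimal subpath of `P + X` meeting `A` and `B`
joins `P₁` and `P₂`", region form.) [cite: BollobasRiordan2010, §5.1 proof of Thm. 5.3] -/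
theorem mem_support_of_adj_region (hn : 1 ≤ n) (htop : ∀ f ∈ dualTopSide n n, f ∉ dualBelow n ω)
    {w : XWalk} (hw : IsSquareCrossing n w.walk)
    (hW1 : ∀ f ∈ lowerHull n ω, walkWinding (extendRight w.walk 0) f = -1)
    (hW0 : ∀ f ∈ dualRectangle n n, f ∉ lowerHull n ω → walkWinding (extendRight w.walk 0) f = 0)
    {a u : Site 2} (ha : a ∈ lowerRegion n ω) (hu : u ∉ lowerRegion n ω)
    (hadj : (zdGraph 2).Adj a u) (ha0 : 0 ≤ a 0) (ha0' : a 0 ≤ n) (hu0 : 0 ≤ u 0) (hu0' : u 0 ≤ n) :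
    a ∈ w.walk.support := by
  obtain ⟨e, he, hae, hb⟩ := exists_isBdryEdge_of_adj hn htop ha hu hadj ha0 ha0' hu0 hu0'
  exact Walk.mem_support_of_mem_edges (mem_edges_of_isBdryEdge hw hW1 hW0 he hb) hae

/-- The edges of an interface walk of the lower hull are open (they are boundary edges of the
explored set, `mem_of_isBdryEdge`). [folklore] -/
theorem mem_of_mem_edges_interface {w : XWalk}
    (hd : ∀ d ∈ w.walk.darts, IsBdryEdge (lowerHull n ω) n d.edge) {e : Sym2 (Site 2)}
    (he : e ∈ w.walk.edges) : e ∈ ω := by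
  obtain ⟨d, hdm, rfl⟩ := List.mem_map.1 he
  exact mem_of_isBdryEdge rfl d.edge_mem
    (isBdryEdge_dualBelow_of_isBdryEdge_lowerHull n d.edge_mem (hd d hdm))

/-- **The lowest crossing as an open interface with the no-entry property.** On `H([0,n]²)`,
`n ≥ 1`, given the winding-number bridge for the interface walks of the lower hull (the extended
walk winds `-1` around the hull faces and `0` around the other faces of the dual square —
`BridgeStatement` of the line, a neighbouring stub): there is a walk `w` in `[0,n]²` from the left
side to the right side, open in `ω`, such that the lower region can only be entered (inside the
strip) through a vertex of `w`. [cite: BollobasRiordan2010, §5.1 proof of Thm. 5.3] -/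
theorem exists_interface (hn : 1 ≤ n) (htop : ∀ f ∈ dualTopSide n n, f ∉ dualBelow n ω)
    (hbridge : ∀ w : XWalk, IsSquareCrossing n w.walk →
      (∀ d ∈ w.walk.darts, IsBdryEdge (lowerHull n ω) n d.edge) →
      (∀ f ∈ lowerHull n ω, walkWinding (extendRight w.walk 0) f = -1) ∧
      (∀ f ∈ dualRectangle n n, f ∉ lowerHull n ω → walkWinding (extendRight w.walk 0) f = 0)) :
    ∃ w : XWalk, IsSquareCrossing n w.walk ∧ (∀ e ∈ w.walk.edges, e ∈ ω) ∧
      ∀ ⦃a u : Site 2⦄, a ∈ lowerRegion n ω → u ∉ lowerRegion n ω → (zdGraph 2).Adj a u →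
        0 ≤ a 0 → a 0 ≤ n → 0 ≤ u 0 → u 0 ≤ n → a ∈ w.walk.support := by
  obtain ⟨w, hw, hd⟩ := exists_lowerInterfaceWalk n htop
  obtain ⟨hW1, hW0⟩ := hbridge w hw hd
  exact ⟨w, hw, fun e he => mem_of_mem_edges_interface hd he, fun a u ha hu hadj ha0 ha0' hu0 hu0' =>
    mem_support_of_adj_region hn htop hw hW1 hW0 ha hu hadj ha0 ha0' hu0 hu0'⟩

end Base

/-! ### Registered glue -/

/-- Statement form of `exists_interface` — "given the winding-number bridge, on `H([0,n]²)` the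
lowest crossing is an open left–right crossing through which alone the lower region can be
entered": a registered glue step the LINE POSITS and proves right below
(`coverInterface_holds`); not a literature fact, never to be relocated. -/
def CoverInterfaceStatement : Prop :=
  ∀ (n : ℕ) (ω : BondConfig (Site 2)), 1 ≤ n → (∀ f ∈ dualTopSide n n, f ∉ dualBelow n ω) →
    (∀ w : XWalk, IsSquareCrossing n w.walk →
      (∀ d ∈ w.walk.darts, IsBdryEdge (lowerHull n ω) n d.edge) →
      (∀ f ∈ lowerHull n ω, walkWinding (extendRight w.walk 0) f = -1) ∧
      (∀ f ∈ dualRectangle n n, f ∉ lowerHull n ω → walkWinding (extendRight w.walk 0) f = 0)) →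
    ∃ w : XWalk, IsSquareCrossing n w.walk ∧ (∀ e ∈ w.walk.edges, e ∈ ω) ∧
      ∀ ⦃a u : Site 2⦄, a ∈ lowerRegion n ω → u ∉ lowerRegion n ω → (zdGraph 2).Adj a u →
        0 ≤ a 0 → a 0 ≤ n → 0 ≤ u 0 → u 0 ≤ n → a ∈ w.walk.support

/-- The lowest crossing as an open interface with the no-entry property, statement form.
[cite: BollobasRiordan2010, §5.1 proof of Thm. 5.3] -/
theorem coverInterface_holds : CoverInterfaceStatement :=
  fun n _ hn htop hbridge => exists_interface (n := n) hn htop hbridge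

end Summit.CriticalPhenomena.CardyFormulaZ2.Cruxes.UniformBoxCrossing.NonSlantLine
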